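import Mathlib
import Summits.NavierStokesRegularity.OSWSelfSimilar.SheetNSLineDecayClass
import Summits.NavierStokesRegularity.OSWSelfSimilar.SheetNSLineCLMPointEmpty
import Summits.NavierStokesRegularity.OSWSelfSimilar.SheetNSLineLpEmpty
import Summits.NavierStokesRegularity.OSWSelfSimilar.SheetNSLineTailSign
import Summits.NavierStokesRegularity.OSWSelfSimilar.SheetNSLineCornerClassification
import HarnessLib

/-!
# Viscous gCLM/OSW profile MODEL: the a-axis census decls of the NS-type line RE-ISSUED IN THE BARE CENSUS CLASS
# (decay binders removed), and the Schochet-corner classification WITHOUT the slope binder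

HONEST FRAMING (cell ns-blowup GROUP B «PROFILE SEARCH», zone Z3 = the 1-D viscous gCLM/OSW sheet; human rulings
D-0035/D-0074): **1-D MODEL; not Euler, not Navier–Stokes; «violates: none — MODEL».** Nothing here is a statement about NS.

THE BARE CENSUS CLASS (CENSUS-Z3 row Z3-E12⁻ clause (i′)): `Ω` odd `C²` (`hodd`, `hOm`, `hdOm`), `|Ω′| ≤ M` (`hM`),
`|Ω(ξ)| ≤ C/(1+ξ²)` (`hC`), MODEL velocity `𝒰′ = HΩ` with the GENUINE `hilbertTransform` (`hU`), `𝒰(0) = 0` (`hU0`), and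
`F₁(c_ω, c_ω/2, a, 1, ε; HΩ, 𝒰, Ω) ≡ 0` on `(0,∞)` (`hF`), blow-up rate `c_ω > 0` (`hcω`).
By `SheetNSLineDecayClass` the decay binders `iUOm`, `iH`, `hUOm`, `hdOm1` of the census decls are theorems of this class
(`hdOm1` for `ε ≥ 0`). This file records the census decls with those binders REMOVED — each `_bare` theorem is the named
tree theorem fed with `decay_iUOm`, `decay_iH`, `decay_hUOm`, `decay_hdOm1` — and nothing else changes:
* `nsTypeLine_tail_law_bare`, `nsTypeLine_tail_pos_of_a_neg_bare`, `nsTypeLine_tail_neg_of_a_pos_signFree_bare` — the tail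
  law `(c_ω/2)ξ²Ω → a∫₀^∞𝒰Ω` and the tail-sign laws ([g11] p540197, [g12] p547035) — binders: the originals MINUS
  `iUOm iH hUOm hdOm1`, PLUS `hcω : 0 < c_ω`, `hε : 0 ≤ ε` (and `hU0` for the tail law) — DISCLOSED: the originals hold for
  every `c_ω`, `ε`; the decay derivation needs `c_ω > 0`, `ε ≥ 0`;
* `nsTypeLine_ESigned_empty_of_a_neg_bare`, `nsTypeLine_empty_of_a_neg_of_eventually_nonpos_bare`,
  `nsTypeLine_empty_of_a_pos_of_eventually_nonneg_bare` — the E-signed / eventually-signed exclusions ([g11], [g12]) —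
  binders: the originals MINUS the four, PLUS `hε : 0 ≤ ε`;
* `nsTypeLine_empty_of_a_eq_zero_bare` — **the CLM point `a = 0` is EMPTY** ([g13] p550887) — binders: the original's 18 MINUS
  `iH`, `hdOm1` (16; velocity-free as before);
* `nsTypeLine_empty_of_a_le_neg_one_bare` — **`a ≤ −1` is EMPTY, sign-free, `ε ≥ 0`** ([g14] p553993) — binders: the original's
  MINUS `hUOm`, PLUS `hU0`;
* `SheetNSLineCorner.corner_slope_bound`, `SheetNSLineCorner.corner_classification_bare` — **AT THE SCHOCHET CORNER
  `(c_ω, c_l, a) = (0,0,0)` the slope binder `hM` is itself a theorem** (`Ω′(y) = Ω′(0) + ∫₀ʸΩ″`, `Ω″ = −(HΩ)Ω/ε ∈ L¹` since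
  `HΩ, Ω ∈ L²`), so the corner classification ([g15] p565337) holds with binders MINUS `M`, `hM` (12 explicit binders):
  every odd `C²` profile with `|Ω| ≤ C/(1+ξ²)` solving `(HΩ)Ω + εΩ″ = 0` on `(0,∞)`, `ε > 0`, is `0` or a Schochet double
  pole `−24εℓη/(η²+ℓ²)²`, `ℓ > 0`.
READING it would support (MODEL, steady; the lead's to letter): the CENSUS-Z3 §3 caveats [g11]/[g13] («in the decay class»,
«in the tail class «ξ(HΩ)Ω ∈ L¹(0,∞), ξΩ′ → 0»») are discharged — every a-axis exclusion holds for every odd `C²` profile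
with `|Ω′| ≤ M`, `|Ω| ≤ C/(1+ξ²)` and the genuine velocity, with no integrability or limit hypothesis; at the corner even
`|Ω′| ≤ M` is automatic. NOT PROVED HERE: anything for `−1 < a < 0` sign-changing, `ε < 0`, anything dynamic, Euler, NS.
No definitions; no `def … : Prop` hypotheses; standard axioms.
bears_on: LADDER-NS N5 / zone Z3 row Z3-E12⁻ clause (i′) (CENSUS-Z3 v2.17 §0 riders [g11]–[g15-corner], §3) → N1 linear core.
-/

noncomputable section
open Set Filter Topology MeasureTheory
open scoped Real

namespace Summit.NavierStokesRegularity.OSWSelfSimilar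
namespace SheetHalfLine
open HouLuoOriginLaws (F1)
open Literature.Analysis.Fourier

/-! ### The tail law and the tail-sign laws in the bare class -/

/-- **TAIL LAW, bare class**: on the NS-type line (`c_ω > 0`, `ε ≥ 0`, any `a`), `(c_ω/2)·ξ²Ω(ξ) → a∫₀^∞𝒰Ω` for every
profile of the bare census class (`nsTypeLine_tail_law` with `iUOm iH hUOm hdOm1` derived). [new here — MODEL] -/
theorem nsTypeLine_tail_law_bare (cω a ε M C : ℝ) (U Om dOm ddOm : ℝ → ℝ) (hcω : 0 < cω) (hε : 0 ≤ ε)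
    (hodd : ∀ y, Om (-y) = -Om y)
    (hOm : ∀ ξ, HasDerivAt Om (dOm ξ) ξ) (hdOm : ∀ ξ, HasDerivAt dOm (ddOm ξ) ξ)
    (hM : ∀ y, |dOm y| ≤ M) (hC : ∀ y, |Om y| ≤ C / (1 + y ^ 2))
    (hU : ∀ ξ, HasDerivAt U (hilbertTransform Om ξ) ξ) (hU0 : U 0 = 0)
    (hF : ∀ ξ ∈ Ioi (0:ℝ), F1 cω (cω / 2) a 1 ε (hilbertTransform Om) U Om dOm ddOm (fun _ => 0) ξ = 0) :
    Tendsto (fun R => cω / 2 * (R ^ 2 * Om R)) atTop (𝓝 (a * ∫ ξ in Ioi (0:ℝ), U ξ * Om ξ)) := by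
  have hdc : Continuous dOm := continuous_iff_continuousAt.mpr fun x => (hdOm x).continuousAt
  exact nsTypeLine_tail_law cω a ε M C U Om dOm ddOm hodd hOm hdOm hM hC hU hF (decay_iUOm hodd hOm hdc hC hU hU0)
    (decay_iH hodd hOm hdc hC) (decay_hUOm hodd hOm hdc hC hU hU0) (decay_hdOm1 hcω hε hodd hOm hdOm hM hC hU hU0 hF)

/-- **TAIL-SIGN LAW `a < 0`, bare class**: a nontrivial profile has a POSITIVE `ξ⁻²` tail,
`(c_ω/2)·ξ²Ω → a∫₀^∞𝒰Ω > 0` (`nsTypeLine_tail_pos_of_a_neg` with the decay binders derived). [new here — MODEL] -/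
theorem nsTypeLine_tail_pos_of_a_neg_bare (cω a ε M C : ℝ) (U Om dOm ddOm : ℝ → ℝ) (hcω : 0 < cω) (hε : 0 ≤ ε)
    (ha : a < 0) (hodd : ∀ y, Om (-y) = -Om y)
    (hOm : ∀ ξ, HasDerivAt Om (dOm ξ) ξ) (hdOm : ∀ ξ, HasDerivAt dOm (ddOm ξ) ξ)
    (hM : ∀ y, |dOm y| ≤ M) (hC : ∀ y, |Om y| ≤ C / (1 + y ^ 2))
    (hU : ∀ ξ, HasDerivAt U (hilbertTransform Om ξ) ξ) (hU0 : U 0 = 0)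
    (hF : ∀ ξ ∈ Ioi (0:ℝ), F1 cω (cω / 2) a 1 ε (hilbertTransform Om) U Om dOm ddOm (fun _ => 0) ξ = 0)
    (hne : Om ≠ 0) :
    Tendsto (fun R => cω / 2 * (R ^ 2 * Om R)) atTop (𝓝 (a * ∫ ξ in Ioi (0:ℝ), U ξ * Om ξ))
      ∧ 0 < a * ∫ ξ in Ioi (0:ℝ), U ξ * Om ξ := by
  have hdc : Continuous dOm := continuous_iff_continuousAt.mpr fun x => (hdOm x).continuousAt
  exact nsTypeLine_tail_pos_of_a_neg cω a ε M C U Om dOm ddOm ha hodd hOm hdOm hM hC hU hU0 hF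
    (decay_iUOm hodd hOm hdc hC hU hU0) (decay_iH hodd hOm hdc hC) (decay_hUOm hodd hOm hdc hC hU hU0)
    (decay_hdOm1 hcω hε hodd hOm hdOm hM hC hU hU0 hF) hne

/-- **TAIL-SIGN LAW `a > 0`, bare class**: a nontrivial profile has a NEGATIVE `ξ⁻²` tail
(`nsTypeLine_tail_neg_of_a_pos_signFree` with the decay binders derived). [new here — MODEL] -/
theorem nsTypeLine_tail_neg_of_a_pos_signFree_bare (cω a ε M C : ℝ) (U Om dOm ddOm : ℝ → ℝ) (hcω : 0 < cω)
    (hε : 0 ≤ ε) (ha : 0 < a) (hodd : ∀ y, Om (-y) = -Om y)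
    (hOm : ∀ ξ, HasDerivAt Om (dOm ξ) ξ) (hdOm : ∀ ξ, HasDerivAt dOm (ddOm ξ) ξ)
    (hM : ∀ y, |dOm y| ≤ M) (hC : ∀ y, |Om y| ≤ C / (1 + y ^ 2))
    (hU : ∀ ξ, HasDerivAt U (hilbertTransform Om ξ) ξ) (hU0 : U 0 = 0)
    (hF : ∀ ξ ∈ Ioi (0:ℝ), F1 cω (cω / 2) a 1 ε (hilbertTransform Om) U Om dOm ddOm (fun _ => 0) ξ = 0)
    (hne : Om ≠ 0) :
    Tendsto (fun R => cω / 2 * (R ^ 2 * Om R)) atTop (𝓝 (a * ∫ ξ in Ioi (0:ℝ), U ξ * Om ξ))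
      ∧ a * ∫ ξ in Ioi (0:ℝ), U ξ * Om ξ < 0 := by
  have hdc : Continuous dOm := continuous_iff_continuousAt.mpr fun x => (hdOm x).continuousAt
  exact nsTypeLine_tail_neg_of_a_pos_signFree cω a ε M C U Om dOm ddOm ha hodd hOm hdOm hM hC hU hU0 hF
    (decay_iUOm hodd hOm hdc hC hU hU0) (decay_iH hodd hOm hdc hC) (decay_hUOm hodd hOm hdc hC hU hU0)
    (decay_hdOm1 hcω hε hodd hOm hdOm hM hC hU hU0 hF) hne

/-! ### The exclusions in the bare class -/

/-- **`a < 0`: NO E-SIGNED PROFILE, bare class** (`c_ω > 0`, `ε ≥ 0`): the census decl `nsTypeLine_ESigned_empty_of_a_neg`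
with `iUOm iH hUOm hdOm1` derived. [new here — MODEL] -/
theorem nsTypeLine_ESigned_empty_of_a_neg_bare (cω a ε M C : ℝ) (U Om dOm ddOm : ℝ → ℝ) (hcω : 0 < cω) (hε : 0 ≤ ε)
    (ha : a < 0) (hodd : ∀ y, Om (-y) = -Om y)
    (hOm : ∀ ξ, HasDerivAt Om (dOm ξ) ξ) (hdOm : ∀ ξ, HasDerivAt dOm (ddOm ξ) ξ)
    (hM : ∀ y, |dOm y| ≤ M) (hC : ∀ y, |Om y| ≤ C / (1 + y ^ 2))
    (hU : ∀ ξ, HasDerivAt U (hilbertTransform Om ξ) ξ) (hU0 : U 0 = 0)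
    (hF : ∀ ξ ∈ Ioi (0:ℝ), F1 cω (cω / 2) a 1 ε (hilbertTransform Om) U Om dOm ddOm (fun _ => 0) ξ = 0)
    (hsign : ∀ ξ ∈ Ioi (0:ℝ), Om ξ ≤ 0) : Om = 0 := by
  have hdc : Continuous dOm := continuous_iff_continuousAt.mpr fun x => (hdOm x).continuousAt
  exact nsTypeLine_ESigned_empty_of_a_neg cω a ε M C U Om dOm ddOm hcω ha hodd hOm hdOm hM hC hU hU0 hF
    (decay_iUOm hodd hOm hdc hC hU hU0) (decay_iH hodd hOm hdc hC) (decay_hUOm hodd hOm hdc hC hU hU0)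
    (decay_hdOm1 hcω hε hodd hOm hdOm hM hC hU hU0 hF) hsign

/-- **`a < 0`: NO PROFILE THAT IS `≤ 0` NEAR `+∞`, bare class** (`c_ω > 0`, `ε ≥ 0`): the census decl
`nsTypeLine_empty_of_a_neg_of_eventually_nonpos` with the decay binders derived. [new here — MODEL] -/
theorem nsTypeLine_empty_of_a_neg_of_eventually_nonpos_bare (cω a ε M C : ℝ) (U Om dOm ddOm : ℝ → ℝ) (hcω : 0 < cω)
    (hε : 0 ≤ ε) (ha : a < 0) (hodd : ∀ y, Om (-y) = -Om y)
    (hOm : ∀ ξ, HasDerivAt Om (dOm ξ) ξ) (hdOm : ∀ ξ, HasDerivAt dOm (ddOm ξ) ξ)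
    (hM : ∀ y, |dOm y| ≤ M) (hC : ∀ y, |Om y| ≤ C / (1 + y ^ 2))
    (hU : ∀ ξ, HasDerivAt U (hilbertTransform Om ξ) ξ) (hU0 : U 0 = 0)
    (hF : ∀ ξ ∈ Ioi (0:ℝ), F1 cω (cω / 2) a 1 ε (hilbertTransform Om) U Om dOm ddOm (fun _ => 0) ξ = 0)
    (hev : ∀ᶠ ξ in atTop, Om ξ ≤ 0) : Om = 0 := by
  have hdc : Continuous dOm := continuous_iff_continuousAt.mpr fun x => (hdOm x).continuousAt
  exact nsTypeLine_empty_of_a_neg_of_eventually_nonpos cω a ε M C U Om dOm ddOm hcω ha hodd hOm hdOm hM hC hU hU0 hF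
    (decay_iUOm hodd hOm hdc hC hU hU0) (decay_iH hodd hOm hdc hC) (decay_hUOm hodd hOm hdc hC hU hU0)
    (decay_hdOm1 hcω hε hodd hOm hdOm hM hC hU hU0 hF) hev

/-- **`a > 0`: NO PROFILE THAT IS `≥ 0` NEAR `+∞`, bare class** (`c_ω > 0`, `ε ≥ 0`): the census decl
`nsTypeLine_empty_of_a_pos_of_eventually_nonneg` with the decay binders derived. [new here — MODEL] -/
theorem nsTypeLine_empty_of_a_pos_of_eventually_nonneg_bare (cω a ε M C : ℝ) (U Om dOm ddOm : ℝ → ℝ) (hcω : 0 < cω)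
    (hε : 0 ≤ ε) (ha : 0 < a) (hodd : ∀ y, Om (-y) = -Om y)
    (hOm : ∀ ξ, HasDerivAt Om (dOm ξ) ξ) (hdOm : ∀ ξ, HasDerivAt dOm (ddOm ξ) ξ)
    (hM : ∀ y, |dOm y| ≤ M) (hC : ∀ y, |Om y| ≤ C / (1 + y ^ 2))
    (hU : ∀ ξ, HasDerivAt U (hilbertTransform Om ξ) ξ) (hU0 : U 0 = 0)
    (hF : ∀ ξ ∈ Ioi (0:ℝ), F1 cω (cω / 2) a 1 ε (hilbertTransform Om) U Om dOm ddOm (fun _ => 0) ξ = 0)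
    (hev : ∀ᶠ ξ in atTop, 0 ≤ Om ξ) : Om = 0 := by
  have hdc : Continuous dOm := continuous_iff_continuousAt.mpr fun x => (hdOm x).continuousAt
  exact nsTypeLine_empty_of_a_pos_of_eventually_nonneg cω a ε M C U Om dOm ddOm hcω ha hodd hOm hdOm hM hC hU hU0 hF
    (decay_iUOm hodd hOm hdc hC hU hU0) (decay_iH hodd hOm hdc hC) (decay_hUOm hodd hOm hdc hC hU hU0)
    (decay_hdOm1 hcω hε hodd hOm hdOm hM hC hU hU0 hF) hev

/-- **THE CLM POINT `a = 0` OF THE NS-TYPE LINE IS EMPTY, bare class** (`c_ω > 0`, `ε > 0`; sign-free, velocity-free):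
the census decl `nsTypeLine_empty_of_a_eq_zero` (p550887) with its tail binders `iH` (`ξ(HΩ)Ω ∈ L¹(0,∞)`) and `hdOm1`
(`ξΩ′ → 0`) DERIVED (`decay_iH`, `decay_hdOm1_of_a_eq_zero`): every odd `C²` profile with `|Ω′| ≤ M`, `|Ω| ≤ C/(1+ξ²)`
solving `F₁(c_ω, c_ω/2, 0, 1, ε; HΩ, 𝒰, Ω) ≡ 0` on `(0,∞)` (genuine `HΩ`, `𝒰` arbitrary) is `≡ 0`. Binders = those of
`nsTypeLine_empty_of_a_eq_zero` MINUS `iH`, `hdOm1`. [new here — MODEL] -/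
theorem nsTypeLine_empty_of_a_eq_zero_bare (cω ε M C : ℝ) (U Om dOm ddOm : ℝ → ℝ) (hcω : 0 < cω) (hε : 0 < ε)
    (hodd : ∀ y, Om (-y) = -Om y)
    (hOm : ∀ ξ, HasDerivAt Om (dOm ξ) ξ) (hdOm : ∀ ξ, HasDerivAt dOm (ddOm ξ) ξ)
    (hM : ∀ y, |dOm y| ≤ M) (hC : ∀ y, |Om y| ≤ C / (1 + y ^ 2))
    (hF : ∀ ξ ∈ Ioi (0:ℝ), F1 cω (cω / 2) 0 1 ε (hilbertTransform Om) U Om dOm ddOm (fun _ => 0) ξ = 0) :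
    Om = 0 := by
  have hdc : Continuous dOm := continuous_iff_continuousAt.mpr fun x => (hdOm x).continuousAt
  exact nsTypeLine_empty_of_a_eq_zero cω ε M C U Om dOm ddOm hcω hε hodd hOm hdOm hM hC hF (decay_iH hodd hOm hdc hC)
    (decay_hdOm1_of_a_eq_zero hcω hε.le hOm hdOm hM hC hF)

/-- **FOR EVERY `a ≤ −1` THE NS-TYPE LINE IS EMPTY, bare class** (`c_ω > 0`, sign-free, every `ε ≥ 0`): the census
decl `nsTypeLine_empty_of_a_le_neg_one` (p553993) with its limit binder `hUOm` (`𝒰Ω → 0`) DERIVED (bounded `𝒰`,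
`Ω → 0`; equation-free). Binders = those of `nsTypeLine_empty_of_a_le_neg_one` MINUS `hUOm`, PLUS `hU0 : 𝒰(0) = 0`.
[new here — MODEL] -/
theorem nsTypeLine_empty_of_a_le_neg_one_bare (cω a ε M C : ℝ) (U Om dOm ddOm : ℝ → ℝ) (hcω : 0 < cω) (hε : 0 ≤ ε)
    (ha : a ≤ -1)
    (hodd : ∀ y, Om (-y) = -Om y)
    (hOm : ∀ ξ, HasDerivAt Om (dOm ξ) ξ) (hdOm : ∀ ξ, HasDerivAt dOm (ddOm ξ) ξ)
    (hM : ∀ y, |dOm y| ≤ M) (hC : ∀ y, |Om y| ≤ C / (1 + y ^ 2))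
    (hU : ∀ ξ, HasDerivAt U (hilbertTransform Om ξ) ξ) (hU0 : U 0 = 0)
    (hF : ∀ ξ ∈ Ioi (0:ℝ), F1 cω (cω / 2) a 1 ε (hilbertTransform Om) U Om dOm ddOm (fun _ => 0) ξ = 0) :
    Om = 0 := by
  have hdc : Continuous dOm := continuous_iff_continuousAt.mpr fun x => (hdOm x).continuousAt
  obtain ⟨B, -, hB⟩ := velocity_bounded hodd hOm hdc hC hU hU0
  -- `𝒰Ω → 0`: bounded `𝒰`, `Ω → 0`
  have hUOm : Tendsto (fun ξ => U ξ * Om ξ) atTop (𝓝 0) := by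
    have h0 : Tendsto (fun ξ => B * |Om ξ|) atTop (𝓝 0) := by
      simpa using ((tendsto_zero_of_env hC).abs).const_mul B
    refine squeeze_zero_norm (fun ξ => ?_) h0
    rw [Real.norm_eq_abs, abs_mul]
    exact mul_le_mul_of_nonneg_right (hB ξ) (abs_nonneg _)
  exact nsTypeLine_empty_of_a_le_neg_one cω a ε M C U Om dOm ddOm hcω hε ha hodd hOm hdOm hM hC hU hF hUOm

end SheetHalfLine

/-! ### The Schochet corner without the slope binder -/

namespace SheetNSLineCorner
open HouLuoOriginLaws (F1)
open Literature.Analysis.Fourier SheetHalfLine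

/-- **(D5) AT THE CORNER THE SLOPE IS BOUNDED A PRIORI.** For an odd `C²` profile with `|Ω| ≤ C/(1+ξ²)` solving
`F₁(0,0,0,1,ε) ≡ 0` on `(0,∞)` (`ε > 0`): `εΩ″ = −(HΩ)Ω` on `ℝ` (`corner_ode`) with `(HΩ)Ω ∈ L¹` (`HΩ, Ω ∈ L²` by the
isometry), hence `|Ω′(y)| ≤ |Ω′(0)| + ∫_ℝ|Ω″|` for every `y`. [new here — MODEL] -/
theorem corner_slope_bound {ε C : ℝ} {U Om dOm ddOm : ℝ → ℝ} (hε : 0 < ε) (hodd : ∀ y, Om (-y) = -Om y)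
    (hOm : ∀ ξ, HasDerivAt Om (dOm ξ) ξ) (hdOm : ∀ ξ, HasDerivAt dOm (ddOm ξ) ξ)
    (hC : ∀ y, |Om y| ≤ C / (1 + y ^ 2))
    (hF : ∀ ξ ∈ Ioi (0:ℝ), F1 0 0 0 1 ε (hilbertTransform Om) U Om dOm ddOm (fun _ => 0) ξ = 0) :
    ∃ M : ℝ, ∀ y, |dOm y| ≤ M := by
  have hc : Continuous Om := continuous_iff_continuousAt.mpr fun x => (hOm x).continuousAt
  have hdc : Continuous dOm := continuous_iff_continuousAt.mpr fun x => (hdOm x).continuousAt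
  have hΩi := integrable_of_env hc hC
  have hΩ2 := memLp_two_of_env hc hC
  have hh2 : MemLp (hilbertTransform Om) 2 :=
    memLp_two_hilbertTransform hΩi hΩ2 (ae_of_all _ (integrableOn_symmIntegrand_of_hasDerivAt hOm hdc hΩi))
  have hI : Integrable (fun y => hilbertTransform Om y * Om y) := hh2.integrable_mul hΩ2
  have hode := corner_ode hodd hOm hdOm hF
  have hdd : ddOm = fun y => -(hilbertTransform Om y * Om y) / ε := by
    funext y; have := hode y; field_simp; linarith
  have hddi : Integrable ddOm := by rw [hdd]; exact (hI.neg).div_const ε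
  refine ⟨|dOm 0| + ∫ y, ‖ddOm y‖, fun y => ?_⟩
  have hFTC : ∫ x in (0:ℝ)..y, ddOm x = dOm y - dOm 0 :=
    intervalIntegral.integral_eq_sub_of_hasDerivAt (fun x _ => hdOm x) (hddi.intervalIntegrable)
  have h1 : |dOm y - dOm 0| ≤ ∫ y, ‖ddOm y‖ := by
    rw [← hFTC, ← Real.norm_eq_abs]
    refine (intervalIntegral.norm_integral_le_integral_norm_uIoc).trans ?_
    exact setIntegral_le_integral hddi.norm (ae_of_all _ fun x => norm_nonneg _)
  have h2 := abs_add_le (dOm 0) (dOm y - dOm 0)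
  rw [add_sub_cancel] at h2
  linarith

/-- **CLASSIFICATION OF THE SCHOCHET CORNER WITHOUT THE SLOPE BINDER (census decl, bare class).** At the corner
`(c_ω, c_l, a) = (0, 0, 0)` of the NS-type line of the frozen-`ε` sheet, `ε > 0`: EVERY odd `C²` profile `Ω`
(`Ω′ = dOm`, `Ω″ = ddOm`) with `|Ω| ≤ C/(1+ξ²)` solving `F₁(0, 0, 0, 1, ε; HΩ, 𝒰, Ω) ≡ 0` on `(0,∞)` with the GENUINE
Hilbert transform (`𝒰` free: its coefficient is `a = 0`) is EITHER `Ω ≡ 0` OR a Schochet double pole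
`Ω(η) = −24εℓ·η/(η²+ℓ²)²`, `ℓ > 0`. Binders = those of `corner_classification` (p565337) MINUS `M`, `hM`
(`corner_slope_bound` supplies them). [new here — MODEL] -/
theorem corner_classification_bare (ε C : ℝ) (U Om dOm ddOm : ℝ → ℝ) (hε : 0 < ε)
    (hodd : ∀ y, Om (-y) = -Om y)
    (hOm : ∀ ξ, HasDerivAt Om (dOm ξ) ξ) (hdOm : ∀ ξ, HasDerivAt dOm (ddOm ξ) ξ)
    (hC : ∀ y, |Om y| ≤ C / (1 + y ^ 2))
    (hF : ∀ ξ ∈ Ioi (0:ℝ), F1 0 0 0 1 ε (hilbertTransform Om) U Om dOm ddOm (fun _ => 0) ξ = 0) :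
    Om = 0 ∨ ∃ ℓ : ℝ, 0 < ℓ ∧ Om = fun η => -(24 * ε * ℓ) * η / (η ^ 2 + ℓ ^ 2) ^ 2 := by
  obtain ⟨M, hM⟩ := corner_slope_bound hε hodd hOm hdOm hC hF
  exact corner_classification ε M C U Om dOm ddOm hε hodd hOm hdOm hM hC hF

end SheetNSLineCorner
end Summit.NavierStokesRegularity.OSWSelfSimilar
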